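import Literature.Analysis.FluidPDE.FluidComputer.GalerkinStability

/-!
# Refining the mask: the coarse Galerkin run is an approximate solution of the fine system whose defect is its SPILL; Gronwall bounds fine − coarse, and the telescoped continuation inherits exactly that error

HONEST FRAMING (cell `pub-fluidc`, verbatim): *low prior, high value-of-information experiment on
Tao's machine paradigm; NOT a claim that NS blows up.* The object is the finite Galerkin system on a mode
set (`GalerkinEnergyBalance.IsGalerkinSolution`) — what a dealiased pseudo-spectral code integrates in exact
arithmetic [cite: DoeringGibbon1995, §5.3 (5.3.13)], [cite: CanutoEtAl2007, §3.3.2 (2/3-rule paragraph)];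
nothing is said about the Navier–Stokes PDE, and no constant is evaluated.

Two masks `T ⊆ S` (coarse ⊆ fine; for the engines: `Dealiasing.box K ⊆ Dealiasing.box K'`, e.g. a `512³`
and a `1024³` run). A Galerkin solution `V` on `T`, supported in `T`, is looked at as a curve in the phase
space of the FINE system (`GalerkinODE.restrict S`):

* `advection_eq_of_subset`, `vf_restrict_of_subset` — at a point supported in `T` the fine field is
  `-ν|k|²V̂(k) + P_k(N_T[V](k) + ĝ(k))` at EVERY `k ∈ S`: on `T` the coarse right-hand side, off `T` the
  Leray-projected nonlinearity the coarse system throws away;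
* `spill T g V k j = P_k(N_T[V](k) + ĝ(k))_j` — that discarded term (one dealiasing shell out it is the
  truncation remainder of the coarse run); `hasDerivAt_restrict_coarse` — the coarse run moves by the fine
  field on `T` and not at all off `T` (`coarseRate`); `dist_coarseRate_vf_le` — hence **its defect as an
  approximate solution of the fine system is the sup of its spill over `S ∖ T`**;
* `dist_fine_coarse_le` (ball form, any forcing, any pressures) and `dist_fine_coarse_le_of_energy_le`
  (unforced, `ν ≥ 0`, same datum, forward in time, radius from the energy): **fine − coarse is bounded by
  `gronwallBound δ K ε (t − t₀) = δe^{K(t−t₀)} + (ε/K)(e^{K(t−t₀)} − 1)`** with `ε` the spill bound on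
  `[t₀, t₁)` and `K = galerkinLipConst S ν R` the fine system's modulus (`GalerkinStability`; the
  "fundamental lemma" [cite: HairerNorsettWanner1993, Thm. I.10.2 (10.14)]); `dist_coeff_fine_coarse_le` —
  coefficientwise;
* `dist_telescoped_le` — **TELESCOPING**: run coarse to `t₁`, continue on the fine mask from the coarse state
  (`W(t₁) = V(t₁)`, any fine Galerkin solution); against the full fine run `U` from the common datum,
  `‖U(t) − W(t)‖_∞ ≤ gronwallBound 0 K ε (t₁ − t₀) · e^{K(t − t₁)}` for `t ≥ t₁` — the continuation inherits
  exactly the refinement error accumulated while the coarse run was used, nothing else.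

Reading for the cell (information for GRID / REFEREE / dns-A on the 'telescoped 512³→1024³ continuation from
the last resolved 512³ time'; never a ruling): the typed notion of "resolved up to `t₁`" that makes the
continuation legitimate is **a bound `ε` on the coarse run's spill `sup_{k ∈ S∖T} |P_k N_T[V(s)](k)|` for
`s < t₁`** — a quantity the coarse engine can emit (it is the part of its own nonlinear term that the mask
removes, read one shell outside the mask) — and the inherited error is `gronwallBound 0 K ε (t₁ − t₀)`; the
modulus `K` is the pessimistic global Lipschitz constant of the fine field on the energy ball (not a usable
number), so the statement fixes the SHAPE of the argument and WHAT to log, not a tolerance.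
No named facts (D-0026); 0 sorry.
-/

noncomputable section

namespace Literature.Analysis.FluidPDE.FluidComputer

open Complex ComplexConjugate Finset Metric Set
open scoped BigOperators NNReal

namespace ShellTransfer

namespace GalerkinODE

variable (S : Finset (Fin 3 → ℤ))

/-! ## Refining the mask: the coarse solution as an approximate solution of the fine system -/

omit S in
/-- For a field supported in `T ⊆ S` the truncated advection term does not see the extra modes:
`N_S[A] = N_T[A]` at EVERY wavevector. [folklore] -/
theorem advection_eq_of_subset (A : FourierVelocity) {T S : Finset (Fin 3 → ℤ)} (hTS : T ⊆ S)
    (hA : ∀ p ∉ T, A.coeff p = 0) (k : Fin 3 → ℤ) : advection A S k = advection A T k := by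
  funext j
  unfold advection
  congr 1
  symm
  refine Finset.sum_subset hTS fun p _ hp => ?_
  rw [hA p hp]
  simp

omit S in
/-- Likewise the energy on the larger mask is the energy on the support. [folklore] -/
theorem truncEnergy_eq_of_subset (A : FourierVelocity) {T S : Finset (Fin 3 → ℤ)} (hTS : T ⊆ S)
    (hA : ∀ p ∉ T, A.coeff p = 0) : truncEnergy A S = truncEnergy A T := by
  unfold truncEnergy
  symm
  refine Finset.sum_subset hTS fun p _ hp => ?_
  unfold modalEnergy
  rw [hA p hp]
  simp

/-- **The Galerkin field of the fine mask at a coarse-supported point**: for `A` supported in `T ⊆ S`,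
`vf_S(restrict_S A)(k) = -ν|k|² Â(k) + P_k( N_T[A](k) + ĝ(k) )` — on `T` this is the coarse right-hand side,
OFF `T` it is the Leray-projected nonlinearity (plus forcing) that the coarse system DISCARDS. [folklore] -/
theorem vf_restrict_of_subset (ν : ℝ) (g : (Fin 3 → ℤ) → Fin 3 → ℂ) (A : FourierVelocity)
    {T : Finset (Fin 3 → ℤ)} (hTS : T ⊆ S) (hA : ∀ p ∉ T, A.coeff p = 0) (k : ↥S) (j : Fin 3) :
    vf S ν g (restrict S A) k j =
      -(ν : ℂ) * (knormSq (k : Fin 3 → ℤ) : ℂ) * A.coeff k j +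
        leray (k : Fin 3 → ℤ) (fun i => advection A T k i + g k i) j := by
  have hA' : ∀ p ∉ S, A.coeff p = 0 := fun p hp => hA p fun h => hp (hTS h)
  unfold vf
  simp only [advArr_restrict S A hA', advection_eq_of_subset A hTS hA]
  rfl

/-- **The SPILL** of a coarse-supported field: the Leray-projected nonlinearity plus forcing,
`P_k( N_T[A](k) + ĝ(k) )` — at `k ∉ T` this is exactly the term the Galerkin system on `T` throws away
(the dealiasing / truncation remainder one shell out). [folklore] -/
def spill (T : Finset (Fin 3 → ℤ)) (g : (Fin 3 → ℤ) → Fin 3 → ℂ) (A : FourierVelocity) (k : Fin 3 → ℤ)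
    (j : Fin 3) : ℂ :=
  leray k (fun i => advection A T k i + g k i) j

omit S in
/-- Unfolding lemma. [folklore] -/
theorem spill_apply (T : Finset (Fin 3 → ℤ)) (g : (Fin 3 → ℤ) → Fin 3 → ℂ) (A : FourierVelocity)
    (k : Fin 3 → ℤ) (j : Fin 3) : spill T g A k j = leray k (fun i => advection A T k i + g k i) j := rfl

/-- The velocity of the coarse solution seen in the fine phase space: the fine field on `T`, zero off `T`.
[folklore] -/
def coarseRate (T : Finset (Fin 3 → ℤ)) (ν : ℝ) (g : (Fin 3 → ℤ) → Fin 3 → ℂ) (x : ↥S → Fin 3 → ℂ) :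
    ↥S → Fin 3 → ℂ :=
  fun k j => if (k : Fin 3 → ℤ) ∈ T then vf S ν g x k j else 0

/-- **A coarse Galerkin solution is a curve in the fine phase space with velocity `coarseRate`**:
on `T` it moves by the fine field (`vf_restrict_of_subset` + `galerkinRHS_eq_vf`), off `T` it does not move.
[folklore] -/
theorem hasDerivAt_restrict_coarse {V : ℝ → FourierVelocity} {T : Finset (Fin 3 → ℤ)} (hTS : T ⊆ S)
    {ν : ℝ} {c : ℝ → (Fin 3 → ℤ) → ℂ} {f : ℝ → (Fin 3 → ℤ) → Fin 3 → ℂ}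
    (hV : IsGalerkinSolution V T ν c f) (hsV : IsSupportedOn V T) (t : ℝ) :
    HasDerivAt (fun s => restrict S (V s)) (coarseRate S T ν (f t) (restrict S (V t))) t := by
  rw [hasDerivAt_pi]
  intro k
  rw [hasDerivAt_pi]
  intro j
  unfold coarseRate
  by_cases hk : (k : Fin 3 → ℤ) ∈ T
  · rw [if_pos hk]
    have h := hV t k hk j
    rw [galerkinRHS_eq_vf T hV hsV t ⟨k, hk⟩ j] at h
    have e : vf T ν (f t) (restrict T (V t)) ⟨k, hk⟩ j = vf S ν (f t) (restrict S (V t)) k j := by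
      rw [vf_restrict_of_subset S ν (f t) (V t) hTS (hsV t) k j,
        vf_restrict_of_subset T ν (f t) (V t) (subset_refl T) (hsV t) ⟨k, hk⟩ j]
    rw [← e]
    exact h
  · rw [if_neg hk]
    have e : (fun s => restrict S (V s) k j) = fun _ => (0 : ℂ) := by
      funext s
      show (V s).coeff k j = 0
      rw [hsV s k hk]
      rfl
    rw [e]
    exact hasDerivAt_const t (0 : ℂ)

/-- **The defect of the coarse solution in the fine system is its spill**: if every discarded component
`P_k(N_T + ĝ)(k)_j`, `k ∈ S ∖ T`, has modulus `≤ ε`, the coarse curve is an `ε`-approximate solution of the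
fine system. [folklore] -/
theorem dist_coarseRate_vf_le {T : Finset (Fin 3 → ℤ)} (hTS : T ⊆ S) (ν : ℝ) (g : (Fin 3 → ℤ) → Fin 3 → ℂ)
    (A : FourierVelocity) (hA : ∀ p ∉ T, A.coeff p = 0) {ε : ℝ} (hε : 0 ≤ ε)
    (h : ∀ k ∈ S, k ∉ T → ∀ j, ‖spill T g A k j‖ ≤ ε) :
    dist (coarseRate S T ν g (restrict S A)) (vf S ν g (restrict S A)) ≤ ε := by
  refine (dist_pi_le_iff hε).2 fun k => (dist_pi_le_iff hε).2 fun j => ?_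
  unfold coarseRate
  by_cases hk : (k : Fin 3 → ℤ) ∈ T
  · rw [if_pos hk, dist_self]
    exact hε
  · rw [if_neg hk, dist_comm, dist_zero_right, vf_restrict_of_subset S ν g A hTS hA k j]
    have hz : A.coeff k j = 0 := by rw [hA k hk]; rfl
    rw [hz, mul_zero, zero_add]
    exact h k k.2 hk j

/-- **MASK REFINEMENT, ball form.** `U` a Galerkin solution on the fine mask `S`, `V` one on the coarse mask
`T ⊆ S` (same `ν`, same forcing, any pressure multipliers), each supported in its mask, both of sup norm
`≤ R` on `[t₀, t₁)`, `‖U(t₀) − V(t₀)‖ ≤ δ`, and the coarse run's SPILL bounded by `ε` there. Then on `[t₀, t₁]`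
`‖U(t) − V(t)‖_∞ ≤ gronwallBound δ K ε (t − t₀) = δe^{K(t−t₀)} + (ε/K)(e^{K(t−t₀)} − 1)`, `K = K_{S,ν,R}`:
the fine and the coarse solution stay close for as long as the coarse run discards little.
[cite: HairerNorsettWanner1993, Thm. I.10.2 (10.14)] -/
theorem dist_fine_coarse_le {U V : ℝ → FourierVelocity} {T : Finset (Fin 3 → ℤ)} (hTS : T ⊆ S) {ν : ℝ}
    {c c' : ℝ → (Fin 3 → ℤ) → ℂ} {f : ℝ → (Fin 3 → ℤ) → Fin 3 → ℂ} (hU : IsGalerkinSolution U S ν c f)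
    (hV : IsGalerkinSolution V T ν c' f) (hsU : IsSupportedOn U S) (hsV : IsSupportedOn V T)
    {t₀ t₁ R δ ε : ℝ} (hε : 0 ≤ ε) (hRU : ∀ s ∈ Ico t₀ t₁, ‖restrict S (U s)‖ ≤ R)
    (hRV : ∀ s ∈ Ico t₀ t₁, ‖restrict S (V s)‖ ≤ R)
    (hspill : ∀ s ∈ Ico t₀ t₁, ∀ k ∈ S, k ∉ T → ∀ j, ‖spill T (f s) (V s) k j‖ ≤ ε)
    (h0 : dist (restrict S (U t₀)) (restrict S (V t₀)) ≤ δ) {t : ℝ} (ht : t ∈ Icc t₀ t₁) :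
    dist (restrict S (U t)) (restrict S (V t)) ≤ gronwallBound δ (galerkinLipConst S ν R) ε (t - t₀) := by
  have hWd : ∀ s, HasDerivAt (fun s => restrict S (V s)) (coarseRate S T ν (f s) (restrict S (V s))) s :=
    fun s => hasDerivAt_restrict_coarse S hTS hV hsV s
  have hWc : Continuous fun s => restrict S (V s) :=
    continuous_iff_continuousAt.2 fun s => (hWd s).continuousAt
  exact dist_restrict_le_of_approx S hU hsU (W := fun s => restrict S (V s)) hWc.continuousOn
    (fun s _ => (hWd s).hasDerivWithinAt)
    (fun s hs => dist_coarseRate_vf_le S hTS ν (f s) (V s) (hsV s) hε (hspill s hs)) hRU hRV h0 ht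

/-- **MASK REFINEMENT FOR UNFORCED RUNS FROM THE SAME DATUM** (Euler `ν = 0` / Navier–Stokes `ν > 0`,
forward in time, no ball hypothesis): if `U` (fine mask `S`) and `V` (coarse mask `T ⊆ S`) start from the
same state of energy `≤ E₀` at `t₀`, then for `t₀ ≤ t ≤ t₁`
`‖U(t) − V(t)‖_∞ ≤ gronwallBound 0 K ε (t − t₀) = (ε/K)(e^{K(t−t₀)} − 1)`, `K = K_{S,ν,√(2E₀)}`,
where `ε` bounds the coarse run's spill `sup_{k∈S∖T} |P_k N_T[V(s)](k)|` on `[t₀, t₁)`. [folklore] -/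
theorem dist_fine_coarse_le_of_energy_le {U V : ℝ → FourierVelocity} {T : Finset (Fin 3 → ℤ)}
    (hTS : T ⊆ S) {ν : ℝ} (hν : 0 ≤ ν) {c c' : ℝ → (Fin 3 → ℤ) → ℂ}
    (hU : IsGalerkinSolution U S ν c fun _ _ _ => 0) (hV : IsGalerkinSolution V T ν c' fun _ _ _ => 0)
    (hsU : IsSupportedOn U S) (hsV : IsSupportedOn V T) {t₀ t₁ E₀ ε : ℝ} (hε : 0 ≤ ε)
    (h0 : U t₀ = V t₀) (hE : truncEnergy (V t₀) T ≤ E₀)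
    (hspill : ∀ s ∈ Ico t₀ t₁, ∀ k ∈ S, k ∉ T → ∀ j, ‖spill T (fun _ _ => 0) (V s) k j‖ ≤ ε)
    {t : ℝ} (ht : t ∈ Icc t₀ t₁) :
    dist (restrict S (U t)) (restrict S (V t)) ≤
      gronwallBound 0 (galerkinLipConst S ν (Real.sqrt (2 * E₀))) ε (t - t₀) := by
  have hEU : truncEnergy (U t₀) S ≤ E₀ := by
    rw [h0, truncEnergy_eq_of_subset (V t₀) hTS (hsV t₀)]
    exact hE
  refine dist_fine_coarse_le S hTS hU hV hsU hsV hε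
    (fun s hs => norm_restrict_le_of_energy_le S hν hU hEU hs.1) (fun s hs => ?_) hspill
    (by rw [h0, dist_self]) ht
  have h1 := norm_restrict_le_sqrt S (V s)
  rw [truncEnergy_eq_of_subset (V s) hTS (hsV s)] at h1
  have h2 : truncEnergy (V s) T ≤ truncEnergy (V t₀) T := truncEnergy_antitone hν hV hs.1
  exact h1.trans (Real.sqrt_le_sqrt (by linarith))

/-- **Coefficientwise reading**: under the hypotheses of `dist_fine_coarse_le_of_energy_le`, every Fourier
coefficient on the fine mask of the fine and the coarse run differ by at most `gronwallBound 0 K ε (t − t₀)`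
(off the fine mask both runs vanish identically). [folklore] -/
theorem dist_coeff_fine_coarse_le {U V : ℝ → FourierVelocity} {T : Finset (Fin 3 → ℤ)}
    (hTS : T ⊆ S) {ν : ℝ} (hν : 0 ≤ ν) {c c' : ℝ → (Fin 3 → ℤ) → ℂ}
    (hU : IsGalerkinSolution U S ν c fun _ _ _ => 0) (hV : IsGalerkinSolution V T ν c' fun _ _ _ => 0)
    (hsU : IsSupportedOn U S) (hsV : IsSupportedOn V T) {t₀ t₁ E₀ ε : ℝ} (hε : 0 ≤ ε)
    (h0 : U t₀ = V t₀) (hE : truncEnergy (V t₀) T ≤ E₀)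
    (hspill : ∀ s ∈ Ico t₀ t₁, ∀ k ∈ S, k ∉ T → ∀ j, ‖spill T (fun _ _ => 0) (V s) k j‖ ≤ ε)
    {t : ℝ} (ht : t ∈ Icc t₀ t₁) {k : Fin 3 → ℤ} (hk : k ∈ S) (j : Fin 3) :
    dist ((U t).coeff k j) ((V t).coeff k j) ≤
      gronwallBound 0 (galerkinLipConst S ν (Real.sqrt (2 * E₀))) ε (t - t₀) :=
  (dist_coeff_le_dist_restrict S (U t) (V t) hk j).trans
    (dist_fine_coarse_le_of_energy_le S hTS hν hU hV hsU hsV hε h0 hE hspill ht)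

/-- **TELESCOPING** (coarse run to `t₁`, then continue on the fine mask from the coarse state): `U` the fine
run from the common datum at `t₀`, `V` the coarse run, `W` ANY fine Galerkin solution with `W(t₁) = V(t₁)`
(the telescoped continuation), all unforced with `ν ≥ 0`. Then for every `t ≥ t₁`
`‖U(t) − W(t)‖_∞ ≤ gronwallBound 0 K ε (t₁ − t₀) · e^{K(t−t₁)}`, `K = K_{S,ν,√(2E₀)}`, `ε` the coarse run's
spill bound on `[t₀, t₁)`: the telescoped run inherits exactly the refinement error accumulated up to the
switch, amplified by the fine system's own modulus afterwards. [folklore] -/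
theorem dist_telescoped_le {U V W : ℝ → FourierVelocity} {T : Finset (Fin 3 → ℤ)} (hTS : T ⊆ S) {ν : ℝ}
    (hν : 0 ≤ ν) {c c' c'' : ℝ → (Fin 3 → ℤ) → ℂ} (hU : IsGalerkinSolution U S ν c fun _ _ _ => 0)
    (hV : IsGalerkinSolution V T ν c' fun _ _ _ => 0) (hW : IsGalerkinSolution W S ν c'' fun _ _ _ => 0)
    (hsU : IsSupportedOn U S) (hsV : IsSupportedOn V T) (hsW : IsSupportedOn W S) {t₀ t₁ E₀ ε : ℝ}
    (hε : 0 ≤ ε) (h0 : U t₀ = V t₀) (hE : truncEnergy (V t₀) T ≤ E₀) (h01 : t₀ ≤ t₁)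
    (hspill : ∀ s ∈ Ico t₀ t₁, ∀ k ∈ S, k ∉ T → ∀ j, ‖spill T (fun _ _ => 0) (V s) k j‖ ≤ ε)
    (h1 : W t₁ = V t₁) {t : ℝ} (ht : t₁ ≤ t) :
    dist (restrict S (U t)) (restrict S (W t)) ≤
      gronwallBound 0 (galerkinLipConst S ν (Real.sqrt (2 * E₀))) ε (t₁ - t₀) *
        Real.exp (galerkinLipConst S ν (Real.sqrt (2 * E₀)) * (t - t₁)) := by
  -- energies at the switch time are still `≤ E₀`
  have hEU0 : truncEnergy (U t₀) S ≤ E₀ := by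
    rw [h0, truncEnergy_eq_of_subset (V t₀) hTS (hsV t₀)]
    exact hE
  have hEU1 : truncEnergy (U t₁) S ≤ E₀ := (truncEnergy_antitone hν hU h01).trans hEU0
  have hEW1 : truncEnergy (W t₁) S ≤ E₀ := by
    rw [h1, truncEnergy_eq_of_subset (V t₁) hTS (hsV t₁)]
    exact (truncEnergy_antitone hν hV h01).trans hE
  -- the error at the switch, then the fine system's own continuous dependence
  have hsw : dist (restrict S (U t₁)) (restrict S (W t₁)) ≤
      gronwallBound 0 (galerkinLipConst S ν (Real.sqrt (2 * E₀))) ε (t₁ - t₀) := by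
    rw [h1]
    exact dist_fine_coarse_le_of_energy_le S hTS hν hU hV hsU hsV hε h0 hE hspill ⟨h01, le_rfl⟩
  have h2 := dist_restrict_le_of_energy_le S hν hU hW hsU hsW hEU1 hEW1 ht
  exact h2.trans (mul_le_mul_of_nonneg_right hsw (Real.exp_pos _).le)

end GalerkinODE

end ShellTransfer

end Literature.Analysis.FluidPDE.FluidComputer

end
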